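import Literature.Analysis.FluidPDE.KNSSTypeIRateSelection
import Literature.Analysis.FluidPDE.LeiZhang2011ZoomIn
import HarnessLib

/-!
# Lei–Zhang 2011, Theorem 1.4, Case 2: the zoom-in centred at the near-maximum (off the axis)

Analysis/FluidPDE **proofs file** (theorems only: no definitions, no named facts, no `sorry`) on
the discharge path of the named fact
`Literature.Analysis.FluidPDE.LeiZhang2011_regularity_bmoStream` (Z. Lei, Q. S. Zhang,
J. Funct. Anal. 261 (2011) = arXiv:1011.5066, **Theorem 1.4**; proof §4, Case 2, pp. 12–13).
In Case 2 of the printed proof (`r_k Q_k → ∞`, `r_k = |x_k'|`) the rescaling (1.6) is centred at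
the near-maximum `x_k` itself, "`x_k` can be chosen so that `θ(x_k) → θ_∞`" by axisymmetry, the
symmetry axis recedes ("`Q_k |x_k + x/Q_k| → ∞`") and "`|v^θ| ≲ 1/r_k`" kills the tangential
component in the limit. In tree terms (the frame of `KNSSTypeIRateSelection` /
`KNSSTypeIRateLimit`, KNSS 2009 Thm. 6.2):

* `exists_meridian_point_norm_eq` — WLOG `(x_k)₁ = 0`, `(x_k)₀ = r_k` (rotate by axisymmetry);
* `zoomAt_isClassicalNSSolutionOn`, `zoomAt_norm_le_two`, `norm_zoomAt_apply_zero_zero`,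
  `zoomAt_hasBMOStreamFunctionOn` — the pair rescaled about `(t_k, x_k)` is a classical solution
  on `(−t_k Q_k², (T − t_k) Q_k²)`, bounded by `2` up to the final time, of norm `1` at `(0, 0)`,
  with the rescaled (`BMO`-norm preserving) stream function;
* `zoomAt_rot_about` — the rescaled slices are axisymmetric about the receding axis through
  `−Q_k r_k e₁` (hypothesis `hsym` of `eq_of_tendstoLocallyUniformly_of_rot_about`);
* `zoomAt_abs_apply_one_le` — `|V₁(s, y)| ≤ (C₁ + 2|y₁|)/(Q_k r_k − |y₀|)` from `|Γ| ≤ C₁` and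
  `‖u‖ ≤ 2Q_k`.

## Mathlib / tree search

Reused: `exists_rotZ_eq_single_add_smul`, `norm_rotZ`, `rotZ_smul_eZ_add_smul`, `rotZ_smul_vec`
(`SereginSverak2009` helpers), `IsClassicalNSSolutionOn.nsRescale_translate_zero`,
`zoom_time_mem`, `zoom_time_mem_Ioc`, `smul_stPull_apply` (`KNSSTypeIIZoomIn`),
`HasBMOStreamFunctionOn.rescale` (`LeiZhang2011StreamRescaling`).

## References

* Z. Lei, Q. S. Zhang, J. Funct. Anal. 261 (2011) = arXiv:1011.5066: Thm. 1.4, proof §4,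
  Case 2 (pp. 12–13). [LeiZhang2011]
* G. Koch, N. Nadirashvili, G. Seregin, V. Šverák, Acta Math. 203 (2009) = arXiv:0709.3599,
  proof of Thm. 6.2 (p. 12). [KochNadirashviliSereginSverak2009]
-/

noncomputable section

open MeasureTheory Set Function Filter Topology TopologicalSpace Metric
open scoped InnerProductSpace RealInnerProductSpace NNReal ENNReal

namespace Literature.Analysis.FluidPDE

open Literature.Analysis.FunctionSpaces SereginSverak2009

section OffAxis

variable {T : ℝ} {u : ℝ → EuclideanSpace ℝ (Fin 3) → EuclideanSpace ℝ (Fin 3)}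
  {p : ℝ → EuclideanSpace ℝ (Fin 3) → ℝ} {t₀ c : ℝ} {x₀ : EuclideanSpace ℝ (Fin 3)}

/-! ### Rotating the near-maximum onto the meridian half-plane -/

/-- **WLOG the near-maximum lies on the meridian half-plane `{x₁ = 0, x₀ ≥ 0}`** (Lei–Zhang,
proof of Thm. 1.4, Case 2: "Due to the axis symmetry of `v`, `x_k` can be chosen so that
`θ(x_k) → θ_∞`", here normalised to `θ = 0`): if `u(t₀, ·)` is axisymmetric, the rotated point
`x₀' = R_θ x₀ = x₀₃ e₃ + |x₀'| e₁` has `‖u(t₀, x₀')‖ = ‖u(t₀, x₀)‖`, `(x₀')₁ = 0`,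
`(x₀')₀ = |x₀'| ≥ 0`, `(x₀')₂ = (x₀)₂`. [cite: LeiZhang2011, Thm. 1.4, proof §4, Case 2 (arXiv p. 12)] -/
theorem exists_meridian_point_norm_eq (haxi : IsAxisymmetric (u t₀))
    (x₀ : EuclideanSpace ℝ (Fin 3)) :
    ∃ x₁ : EuclideanSpace ℝ (Fin 3), x₁ 1 = 0 ∧ x₁ 0 = cylRadius x₀ ∧ x₁ 2 = x₀ 2 ∧
      ‖u t₀ x₁‖ = ‖u t₀ x₀‖ := by
  obtain ⟨θ, hθ⟩ := exists_rotZ_eq_single_add_smul x₀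
  refine ⟨rotZ θ x₀, ?_, ?_, ?_, ?_⟩
  · rw [hθ]; simp
  · rw [hθ]; simp
  · rw [hθ]; simp
  · rw [haxi θ x₀, norm_rotZ]

/-! ### The zoom centred at a point of the meridian half-plane -/

/-- **The off-axis rescaled pair is a classical solution** on
`(−t₀/c², (T − t₀)/c²)`: `c u(t₀ + c² s, x₀ + c y)`, `c² p(…)` (`c > 0`;
`IsClassicalNSSolutionOn.nsRescale_translate_zero`). [cite: LeiZhang2011, Thm. 1.4, proof §4, (1.6) (arXiv p. 12)] -/
theorem zoomAt_isClassicalNSSolutionOn (h : IsClassicalNSSolutionOn (Ioo 0 T) 1 0 u p) (hc : 0 < c)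
    (t₀ : ℝ) (x₀ : EuclideanSpace ℝ (Fin 3)) :
    IsClassicalNSSolutionOn (Ioo (-(t₀ / c ^ 2)) ((T - t₀) / c ^ 2)) 1 0
      (c • stPull (c ^ 2) c t₀ x₀ u) (c ^ 2 • stPull (c ^ 2) c t₀ x₀ p) :=
  (h.nsRescale_translate_zero hc t₀ x₀).mono (fun _ hs => zoom_time_mem hc.ne' hs)
    (uniqueDiffOn_Ioo _ _)

/-- The off-axis rescaled velocity is bounded by `2` up to the final time when
`‖u‖ ≤ 2‖u(t₀, x₀)‖` on `(0, t₀] × ℝ³` and `c = ‖u(t₀, x₀)‖⁻¹`. [cite: LeiZhang2011, Thm. 1.4, proof §4, (1.6) (arXiv p. 12)] -/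
theorem zoomAt_norm_le_two (hsel : ∀ s ∈ Ioc 0 t₀, ∀ y, ‖u s y‖ ≤ 2 * ‖u t₀ x₀‖)
    (hM : 0 < ‖u t₀ x₀‖) (hc : c = ‖u t₀ x₀‖⁻¹) :
    ∀ s ∈ Ioc (-(t₀ / c ^ 2)) 0, ∀ y,
      ‖(c • stPull (c ^ 2) c t₀ x₀ u) s y‖ ≤ 2 := by
  intro s hs y
  have hc0 : 0 < c := by rw [hc]; positivity
  rw [smul_stPull_apply, norm_smul, Real.norm_eq_abs, abs_of_pos hc0]
  have h1 := hsel _ (zoom_time_mem_Ioc hc0.ne' hs) (x₀ + c • y)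
  calc c * ‖u (t₀ + c ^ 2 * s) (x₀ + c • y)‖ ≤ c * (2 * ‖u t₀ x₀‖) :=
        mul_le_mul_of_nonneg_left h1 hc0.le
    _ = 2 := by rw [hc]; field_simp

/-- At `(s, y) = (0, 0)` the off-axis rescaled velocity is `c u(t₀, x₀)`, of norm `1` for
`c = ‖u(t₀, x₀)‖⁻¹ > 0` ("`|u(0, 0)| = 1`", arXiv p. 12). [cite: LeiZhang2011, Thm. 1.4, proof §4 (arXiv p. 12)] -/
theorem norm_zoomAt_apply_zero_zero (hM : 0 < ‖u t₀ x₀‖) (hc : c = ‖u t₀ x₀‖⁻¹) :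
    ‖(c • stPull (c ^ 2) c t₀ x₀ u) 0 0‖ = 1 := by
  have hc0 : 0 < c := by rw [hc]; positivity
  rw [smul_stPull_apply, mul_zero, add_zero, smul_zero, add_zero, norm_smul, Real.norm_eq_abs,
    abs_of_pos hc0, hc, inv_mul_cancel₀ hM.ne']

/-- The stream class along the off-axis zoom (`HasBMOStreamFunctionOn.rescale`). [cite: LeiZhang2011, Thm. 1.4, proof §4 (arXiv p. 12)] -/
theorem zoomAt_hasBMOStreamFunctionOn
    {B : ℝ → EuclideanSpace ℝ (Fin 3) → EuclideanSpace ℝ (Fin 3)} {K : ℝ≥0}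
    (hB : HasBMOStreamFunctionOn (Ioo 0 T) u B K) (hc : c ≠ 0) (t₀ : ℝ)
    (x₀ : EuclideanSpace ℝ (Fin 3)) :
    HasBMOStreamFunctionOn (Ioo (-(t₀ / c ^ 2)) ((T - t₀) / c ^ 2))
      (c • stPull (c ^ 2) c t₀ x₀ u) (stPull (c ^ 2) c t₀ x₀ B) K :=
  fun s hs => (hB.rescale t₀ x₀ hc) s (zoom_time_mem hc hs)

/-! ### Symmetry about the receding axis -/

/-- A point of the meridian half-plane minus its `e₁`-component is on the axis:
`x₀ − (x₀)₀ e₁ = (x₀)₂ e₃` when `(x₀)₁ = 0`. [folklore] -/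
theorem sub_smul_single_zero_eq_smul_eZ (hx : x₀ 1 = 0) :
    x₀ - x₀ 0 • (EuclideanSpace.single 0 (1 : ℝ) : EuclideanSpace ℝ (Fin 3)) = x₀ 2 • eZ := by
  ext i
  fin_cases i <;> simp [eZ, hx]

/-- **The off-axis rescaled slices are axisymmetric about the receding axis through
`−(c⁻¹ (x₀)₀) e₁`** (the axis of `u` seen in the rescaled coordinates; in the printed proof
"`Q_k |x_k + x/Q_k| → ∞`", here in the form `hsym` of
`eq_of_tendstoLocallyUniformly_of_rot_about`): for `(x₀)₁ = 0`, `c ≠ 0` and `u(t, ·)`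
axisymmetric at `t = t₀ + c² s`, with `a = −(c⁻¹ (x₀)₀) e₁`,
`V(s, a + R_θ(y − a)) = R_θ V(s, y)`. [cite: LeiZhang2011, Thm. 1.4, proof §4, Case 2 (arXiv pp. 12–13)] -/
theorem zoomAt_rot_about (hx : x₀ 1 = 0) (hc : c ≠ 0) {s : ℝ}
    (haxi : IsAxisymmetric (u (t₀ + c ^ 2 * s))) (θ : ℝ) (y : EuclideanSpace ℝ (Fin 3)) :
    (c • stPull (c ^ 2) c t₀ x₀ u) s
        (EuclideanSpace.single 0 (-(c⁻¹ * x₀ 0)) +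
          rotZ θ (y - EuclideanSpace.single 0 (-(c⁻¹ * x₀ 0)))) =
      rotZ θ ((c • stPull (c ^ 2) c t₀ x₀ u) s y) := by
  set a : EuclideanSpace ℝ (Fin 3) := EuclideanSpace.single 0 (-(c⁻¹ * x₀ 0)) with ha
  have hca : x₀ + c • a = x₀ 2 • eZ := by
    rw [← sub_smul_single_zero_eq_smul_eZ hx, ha, sub_eq_add_neg]
    congr 1
    ext i
    fin_cases i <;> (simp; try field_simp)
  rw [smul_stPull_apply, smul_stPull_apply]
  have h1 : x₀ + c • (a + rotZ θ (y - a)) = rotZ θ (x₀ + c • y) := by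
    have h2 : x₀ + c • y = x₀ 2 • eZ + c • (y - a) := by
      rw [smul_sub, ← hca]; abel
    rw [smul_add, ← add_assoc, hca, h2, rotZ_smul_eZ_add_smul]
  rw [h1, haxi θ, rotZ_smul_vec]

/-! ### The tangential component is small -/

/-- **The tangential component of the off-axis rescaled velocity is small** (Lei–Zhang, proof
of Thm. 1.4, Case 2: from `|Γ| ≤ C₁`, "`|v^θ(t, y)| ≲ 1/r_k`", and `Q_k r_k → ∞`). For
`(x₀)₁ = 0`, `c = M⁻¹ > 0`, `‖u‖ ≤ 2M` at the time `t₀ + c² s` and `|swirl u| ≤ C₁` there: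
at every `y` with `|y₀| < M (x₀)₀`,
`|V(s, y)₁| ≤ (C₁ + 2|y₁|) / (M (x₀)₀ − |y₀|)` (since `x₀ + c y` has `x₀`-coordinate
`(x₀)₀ + c y₀ > 0` and `u₁ = (Γ + x₁ u₀)/x₀`). [cite: LeiZhang2011, Thm. 1.4, proof §4, Case 2 (arXiv pp. 12–13)] -/
theorem zoomAt_abs_apply_one_le (hx : x₀ 1 = 0) {M : ℝ} (hM : 0 < M) (hc : c = M⁻¹) {s : ℝ} {C₁ : ℝ}
    (hswirl : ∀ x, |swirl (u (t₀ + c ^ 2 * s)) x| ≤ C₁)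
    (hbd : ∀ x, ‖u (t₀ + c ^ 2 * s) x‖ ≤ 2 * M) {y : EuclideanSpace ℝ (Fin 3)}
    (hy : |y 0| < M * x₀ 0) :
    |(c • stPull (c ^ 2) c t₀ x₀ u) s y 1| ≤ (C₁ + 2 * |y 1|) / (M * x₀ 0 - |y 0|) := by
  have hc0 : 0 < c := by rw [hc]; positivity
  set x : EuclideanSpace ℝ (Fin 3) := x₀ + c • y with hxdef
  set w : EuclideanSpace ℝ (Fin 3) := u (t₀ + c ^ 2 * s) x with hw
  have hx0 : x 0 = x₀ 0 + c * y 0 := by simp [hxdef]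
  have hx1 : x 1 = c * y 1 := by simp [hxdef, hx]
  have hden : 0 < M * x₀ 0 - |y 0| := by linarith
  have hx0pos : 0 < x 0 := by
    rw [hx0, hc]
    have : M⁻¹ * (M * x₀ 0 - |y 0|) ≤ x₀ 0 + M⁻¹ * y 0 := by
      rw [mul_sub, ← mul_assoc, inv_mul_cancel₀ hM.ne', one_mul]
      linarith [neg_abs_le (y 0), mul_le_mul_of_nonneg_left (neg_abs_le (y 0)) (inv_pos.2 hM).le]
    nlinarith [mul_pos (inv_pos.2 hM) hden]
  -- `u₁ = (Γ + x₁ u₀) / x₀`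
  have hsw : swirl (u (t₀ + c ^ 2 * s)) x = x 0 * w 1 - x 1 * w 0 := rfl
  have hw1 : w 1 = (swirl (u (t₀ + c ^ 2 * s)) x + x 1 * w 0) / x 0 := by
    rw [hsw]; field_simp; ring
  have hV1 : (c • stPull (c ^ 2) c t₀ x₀ u) s y 1 = c * w 1 := by
    rw [smul_stPull_apply]; simp [hw, hxdef]
  have hw0 : |w 0| ≤ 2 * M := by
    calc |w 0| = ‖w 0‖ := (Real.norm_eq_abs _).symm
      _ ≤ ‖w‖ := PiLp.norm_apply_le w 0
      _ ≤ 2 * M := hbd x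
  rw [hV1, hw1, abs_mul, abs_of_pos hc0, abs_div, abs_of_pos hx0pos]
  -- `c (|Γ| + |x₁| |u₀|) / x₀ ≤ (C₁ + 2|y₁|) / (M x₀₀ − |y₀|)`
  have hnum : |swirl (u (t₀ + c ^ 2 * s)) x + x 1 * w 0| ≤ C₁ + c * |y 1| * (2 * M) := by
    calc |swirl (u (t₀ + c ^ 2 * s)) x + x 1 * w 0|
        ≤ |swirl (u (t₀ + c ^ 2 * s)) x| + |x 1 * w 0| := abs_add_le _ _
      _ ≤ C₁ + |x 1| * |w 0| := by rw [abs_mul]; exact add_le_add (hswirl x) le_rfl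
      _ ≤ C₁ + c * |y 1| * (2 * M) := by
          rw [hx1, abs_mul, abs_of_pos hc0]
          gcongr
  rw [← mul_div_assoc, div_le_div_iff₀ hx0pos hden]
  have h2 : c * |swirl (u (t₀ + c ^ 2 * s)) x + x 1 * w 0| * (M * x₀ 0 - |y 0|) ≤
      (C₁ + c * |y 1| * (2 * M)) * (c * (M * x₀ 0 - |y 0|)) := by
    have := mul_le_mul_of_nonneg_right hnum (mul_nonneg hc0.le hden.le)
    nlinarith [this]
  have h3 : c * (M * x₀ 0 - |y 0|) ≤ x 0 := by
    rw [hx0, hc, mul_sub, ← mul_assoc, inv_mul_cancel₀ hM.ne', one_mul]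
    nlinarith [neg_abs_le (y 0), le_abs_self (y 0), inv_pos.2 hM]
  have h4 : c * |y 1| * (2 * M) = 2 * |y 1| := by rw [hc]; field_simp
  calc c * |swirl (u (t₀ + c ^ 2 * s)) x + x 1 * w 0| * (M * x₀ 0 - |y 0|)
      ≤ (C₁ + c * |y 1| * (2 * M)) * (c * (M * x₀ 0 - |y 0|)) := h2
    _ ≤ (C₁ + c * |y 1| * (2 * M)) * x 0 := by
        refine mul_le_mul_of_nonneg_left h3 ?_
        have : 0 ≤ C₁ := (abs_nonneg _).trans (hswirl x)
        positivity
    _ = (C₁ + 2 * |y 1|) * x 0 := by rw [h4]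

end OffAxis

end Literature.Analysis.FluidPDE
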